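import Summits.QuantumFields.BalabanUV.T4Continuum.Support.NE7SliceCriticalBranchLift
import Summits.QuantumFields.BalabanUV.T4Continuum.Support.NE7MinimiserSectionLift
import HarnessLib

/-!
# NE7MinimiserC1Lift — `U_k(V)` IS `C¹` IN THE DATUM AROUND ANY MINIMISER WHOSE DATUM'S STABILISERS LIFT TO FINE GAUGES FIXING IT (ROAD-G115 §1): ✓ p825999
# `NE7MinimiserC1StabConst.minimiser_contDiffAt_of_stab_const` with (G3) «every unitary `N`-periodic stabiliser of `V₀` is a constant gauge `c` fixing `U♯`» weakened to (G3′) «every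
# unitary `N`-periodic stabiliser `s` of `V₀` LIFTS to a unitary `(N·L^{j+1})`-periodic gauge `h` with `h·U♯ = U♯` and corner values `s`» — which ✓ p824904
# `NE7StabiliserLifting.stabiliser_lifting` (row NE7b, Palais' symmetric criticality on the lattice, [NE7bP1-G158-INBOX-2∕3∕4]) PROVES at every small datum, level by level; the discharge
# is `NE7MinimiserC1AllData`.  ASSEMBLY of `NE7SliceCriticalBranchLift.slice_critical_branch_of_lift` (the slice package and the `C¹` critical branch `z⋆`) and
# `NE7MinimiserSectionLift.minimiser_section_of_lift` (the branch is a section of minimisers): `Ψ(y) := θ_Σ(y, ι_K z⋆(y))`, `minAct(chart_{V₀} y) = w·g(y, z⋆(y))` with `g` `C²`, `z⋆` `C¹`.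

Cell `pub-balaban`, rung (B)+1 sub-cell t4, lineage `b2b-balaban-t4-ne7-p1` (CRUX PROVER NE7 #1 = OWNER of BINDER row NE7), generation 115.  Memo `t4/b2b-balaban-t4-ne7-p1-g115/ROAD-G115.md` §1.
WHAT ([folklore]; 0 def, 0 sorry; `d = 4`, every `U(n)`, `L ≥ 2`).  **`minimiser_contDiffAt_of_lift`**.
HONEST FRAMING (page 1): composition of landed kernel theorems; radii∕constants existential; (G3′) is a HYPOTHESIS here (discharged in `NE7MinimiserC1AllData`); `C¹`, NOT the analyticity [B11]
asserts; nothing of Bałaban's asserted; NOT NE7 as a spine node, NOT NE3; spine 0∕9; finite T⁴ rung (B)+1 — NOT infinite volume, NOT mass gap, NOT BetaPertH, NOT Clay.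
-/

set_option autoImplicit false

open scoped BigOperators Matrix Matrix.Norms.L2Operator Topology
open NormedSpace Finset Set Filter Metric

namespace Summit.QuantumFields.BalabanUV.T4Continuum.NE7MinimiserC1Lift

open Literature.MathematicalPhysics.QuantumFieldTheory.Balaban1983to89
open B7Prop1Explicit B7Prop2Explicit
open T4AveragingDeficitWall (IsUnitaryCfg SmallField fineAction)
open T4AveragingDeficitWallBoundary (IsPeriodicCfg)
open AveragingDeficitTorusChart (TDir chart)
open AveragingDeficitTwoLevelPrep (skewSub)
open AveragingDeficitMultiLevelPrep (tower tower_ne_zero)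
open MinimalActionLevels (perWin levelAction stepWt stepWt_pos)
open MinimalActionSandwich (IsMinimiser minAct)
open MinimalActionRate (sfClass)
open NE3EnergyShapes (IsUnitarySite IsPeriodicSite)
open NE7MinimalOrbitDatumContinuity (thresholds)
open NE7MinimalOrbitUniqueGeneric (minimal_orbit_unique_generic)
open BlockAverageCurrent (smallField_gaugeAct)
open NE7SliceCriticalBranchLift (slice_critical_branch_of_lift)
open NE7MinimiserSectionLift (minimiser_section_of_lift)

noncomputable section

variable {n : Type} [Fintype n] [DecidableEq n]

set_option maxHeartbeats 1600000 in
/-- **`U_k(V)` IS `C¹` IN `V` AROUND A MINIMISER WITH (G3′), AND SO IS THE MINIMAL ACTION** (see the module docstring): for every minimiser `U♯` over a small unitary `N`-periodic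
`V₀` whose unitary `N`-periodic stabilisers lift to unitary `(N·L^{j+1})`-periodic gauges fixing `U♯`: `∃ Ψ` `C¹` at `0`, `Ψ 0 = 0`, `chart_{U♯} Ψ(y)` a minimiser over `chart_{V₀} y`
for `y` near `0`, and `y ↦ minAct(chart_{V₀} y)` `C¹` at `0`. [folklore] -/
theorem minimiser_contDiffAt_of_lift [Nonempty n] {L : ℕ} [NeZero L] (hL : 2 ≤ L) :
    ∃ ε₀ : ℝ, 0 < ε₀ ∧ ∀ ε : ℝ, 0 < ε → ε ≤ ε₀ → ∀ (N : ℕ) [NeZero N], 1 ≤ N →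
      ∃ δV : ℝ, 0 < δV ∧
        ∀ V₀ ∈ {V : Site 4 → Fin 4 → (Matrix n n ℂ)ˣ | IsUnitaryCfg V ∧ IsPeriodicCfg V (N : ℤ) ∧ SmallField V δV},
        ∀ (j : ℕ) (Us : Site 4 → Fin 4 → (Matrix n n ℂ)ˣ), IsMinimiser 4 (sfClass 4 L N ε) L N (j + 1) V₀ Us →
        (∀ s : Site 4 → (Matrix n n ℂ)ˣ, IsUnitarySite s → IsPeriodicSite s (N : ℤ) → gaugeAct s V₀ = V₀ →
            ∃ h : Site 4 → (Matrix n n ℂ)ˣ, IsUnitarySite h ∧ IsPeriodicSite h ((N * L ^ (j + 1) : ℕ) : ℤ) ∧ gaugeAct h Us = Us ∧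
              ∀ z : Site 4, h (((L : ℤ) ^ (j + 1)) • z) = s z) →
        ∃ Ψ : ↥(skewSub 4 n N) → ↥(skewSub 4 n (L * tower L N j)), ContDiffAt ℝ 1 Ψ 0 ∧ Ψ 0 = 0 ∧
          (∀ᶠ y : ↥(skewSub 4 n N) in 𝓝 0, IsMinimiser 4 (sfClass 4 L N ε) L N (j + 1) (chart (ContinuousLinearMap.id ℝ (Matrix n n ℂ)) N V₀ (y : TDir 4 n N))
            (chart (ContinuousLinearMap.id ℝ (Matrix n n ℂ)) (L * tower L N j) Us ((Ψ y : ↥(skewSub 4 n (L * tower L N j))) : TDir 4 n (L * tower L N j)))) ∧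
          ContDiffAt ℝ 1 (fun y : ↥(skewSub 4 n N) => minAct 4 (sfClass 4 L N ε) L N (j + 1) (chart (ContinuousLinearMap.id ℝ (Matrix n n ℂ)) N V₀ (y : TDir 4 n N))) 0 := by
  have hL1 : 1 ≤ L := by omega
  obtain ⟨ε₁, hε₁, H⟩ := thresholds (n := n) hL
  obtain ⟨ε₃, hε₃, H3⟩ := minimal_orbit_unique_generic (n := n) hL
  obtain ⟨ε₅, hε₅, H5⟩ := slice_critical_branch_of_lift (n := n) hL
  obtain ⟨ε₆, hε₆, H6⟩ := minimiser_section_of_lift (n := n) hL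
  refine ⟨min ε₁ (min ε₃ (min ε₅ ε₆)), lt_min hε₁ (lt_min hε₃ (lt_min hε₅ hε₆)), fun ε hε hεle N _ hN => ?_⟩
  obtain ⟨-, -, -, H1⟩ := H ε hε (hεle.trans (min_le_left _ _))
  obtain ⟨δ₁, hδ₁, hint₁⟩ := H1 N hN
  obtain ⟨δ₃, hδ₃, huniq⟩ := H3 ε hε (hεle.trans ((min_le_right _ _).trans (min_le_left _ _))) N hN
  have hS5 := H5 ε hε (hεle.trans ((min_le_right _ _).trans ((min_le_right _ _).trans (min_le_left _ _)))) N hN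
  obtain ⟨δ₆, hδ₆, hsec⟩ := H6 ε hε (hεle.trans ((min_le_right _ _).trans ((min_le_right _ _).trans (min_le_right _ _)))) N hN
  refine ⟨min δ₁ (min δ₃ δ₆), lt_min hδ₁ (lt_min hδ₃ hδ₆), fun V₀ hV₀ j Us hUs hlift => ?_⟩
  obtain ⟨hV₀u, hV₀P, hV₀δ⟩ := hV₀
  have hV₀1 : V₀ ∈ {V : Site 4 → Fin 4 → (Matrix n n ℂ)ˣ | IsUnitaryCfg V ∧ IsPeriodicCfg V (N : ℤ) ∧ SmallField V δ₁} :=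
    ⟨hV₀u, hV₀P, MinimalActionRate.SmallField.mono hV₀δ (min_le_left _ _)⟩
  have hV₀3 : V₀ ∈ {V : Site 4 → Fin 4 → (Matrix n n ℂ)ˣ | IsUnitaryCfg V ∧ IsPeriodicCfg V (N : ℤ) ∧ SmallField V δ₃} :=
    ⟨hV₀u, hV₀P, MinimalActionRate.SmallField.mono hV₀δ ((min_le_right _ _).trans (min_le_left _ _))⟩
  have hV₀6 : V₀ ∈ {V : Site 4 → Fin 4 → (Matrix n n ℂ)ˣ | IsUnitaryCfg V ∧ IsPeriodicCfg V (N : ℤ) ∧ SmallField V δ₆} :=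
    ⟨hV₀u, hV₀P, MinimalActionRate.SmallField.mono hV₀δ ((min_le_right _ _).trans (min_le_right _ _))⟩
  -- interiority of `U♯` (via the orbit of an interior minimiser)
  obtain ⟨U₀, hU₀, a, ha0, haε, hU₀a⟩ := hint₁ V₀ hV₀1 (j + 1)
  obtain ⟨Ur, -, horbit⟩ := huniq V₀ hV₀3 (j + 1)
  obtain ⟨u₁, hu₁, -, hg₁⟩ := horbit U₀ hU₀
  obtain ⟨u₂, hu₂, -, hg₂⟩ := horbit Us hUs
  have hUsa : SmallField Us a := by
    have h1 : SmallField Ur a := by rw [← hg₁]; exact smallField_gaugeAct hu₁ hU₀a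
    have h2 : gaugeAct (fun z => (u₂ z)⁻¹) Ur = Us := by rw [← hg₂, AveragingDeficitKDatum.gaugeAct_inv_gaugeAct]
    rw [← h2]; exact smallField_gaugeAct (fun z => (unitaryUnits _).inv_mem (hu₂ z)) h1
  haveI : NeZero (L * tower L N j) := ⟨Nat.mul_ne_zero (NeZero.ne L) (tower_ne_zero L N j)⟩
  -- (S5) the slice package and the critical branch; (S6) the branch is a section of minimisers
  obtain ⟨Sl, ξ, σ, θS, KT, iK, πT, zs, hSlle, hξc, hσc, hξ0, hσ0, hprop, hright, hθSc, hθS0, hfibS, hiK, -, hπTsec, hKp, hgc, hzsc, hzs0, -, -, hzsuniq⟩ :=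
    hS5 V₀ j Us hV₀u hV₀P hUs a ha0 haε hUsa hlift
  have hkey := hsec V₀ hV₀6 j Us hUs hlift Sl ξ σ θS KT iK πT zs hξc hσc hξ0 hσ0 hprop hright hfibS hiK hπTsec hKp hzsuniq
  haveI : CompleteSpace ↥Sl := FiniteDimensional.complete ℝ _
  haveI : CompleteSpace ↥KT := FiniteDimensional.complete ℝ _
  set w : ℝ := ((stepWt 4 L)⁻¹) ^ (j + 1) with hw
  have hlev : ∀ Z : Site 4 → Fin 4 → (Matrix n n ℂ)ˣ, levelAction 4 L N (j + 1) Z = w * fineAction Z (perWin 4 (N * L ^ (j + 1))) := fun Z => by rw [hw]; rfl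
  set g : ↥(skewSub 4 n N) × ↥KT → ℝ := fun p : ↥(skewSub 4 n N) × ↥KT =>
    fineAction (chart (ContinuousLinearMap.id ℝ (Matrix n n ℂ)) (L * tower L N j) Us ((θS (p.1, iK p.2) : ↥Sl) : TDir 4 n (L * tower L N j)))
      (perWin 4 (N * L ^ (j + 1))) with hg
  -- the section `Ψ`
  set inclSl : ↥Sl →L[ℝ] ↥(skewSub 4 n (L * tower L N j)) := LinearMap.toContinuousLinearMap (Submodule.inclusion hSlle) with hinclSl
  set Ψ : ↥(skewSub 4 n N) → ↥(skewSub 4 n (L * tower L N j)) := fun y => inclSl (θS (y, iK (zs y))) with hΨ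
  have hΨval : ∀ y, ((Ψ y : ↥(skewSub 4 n (L * tower L N j))) : TDir 4 n (L * tower L N j)) = ((θS (y, iK (zs y)) : ↥Sl) : TDir 4 n (L * tower L N j)) :=
    fun y => rfl
  have hsec1 : ContDiffAt ℝ 1 (fun y : ↥(skewSub 4 n N) => ((y, iK (zs y)) : ↥(skewSub 4 n N) × ↥Sl)) 0 :=
    contDiffAt_id.prodMk (iK.contDiff.contDiffAt.comp 0 hzsc)
  have hsec0 : (fun y : ↥(skewSub 4 n N) => ((y, iK (zs y)) : ↥(skewSub 4 n N) × ↥Sl)) 0 = 0 := by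
    simp only [hzs0, map_zero, Prod.mk_zero_zero]
  have hθsec : ContDiffAt ℝ 1 (fun y : ↥(skewSub 4 n N) => θS (y, iK (zs y))) 0 := by
    have h1 : ContDiffAt ℝ 1 θS ((fun y : ↥(skewSub 4 n N) => ((y, iK (zs y)) : ↥(skewSub 4 n N) × ↥Sl)) 0) := by
      rw [hsec0]; exact hθSc.of_le (by norm_num)
    exact h1.comp 0 hsec1
  have hΨc : ContDiffAt ℝ 1 Ψ 0 := inclSl.contDiff.contDiffAt.comp 0 hθsec
  have hΨ0 : Ψ 0 = 0 := by simp only [hΨ, hzs0, map_zero]; rw [Prod.mk_zero_zero, hθS0, map_zero]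
  have hkeyΨ : ∀ᶠ y : ↥(skewSub 4 n N) in 𝓝 0, IsMinimiser 4 (sfClass 4 L N ε) L N (j + 1) (chart (ContinuousLinearMap.id ℝ (Matrix n n ℂ)) N V₀ (y : TDir 4 n N))
      (chart (ContinuousLinearMap.id ℝ (Matrix n n ℂ)) (L * tower L N j) Us ((Ψ y : ↥(skewSub 4 n (L * tower L N j))) : TDir 4 n (L * tower L N j))) :=
    hkey.mono fun y hy => by rw [hΨval y]; exact hy
  -- the minimal action is `w · g(y, z⋆(y))` near `0`, hence `C¹`
  have hminAct : ∀ᶠ y : ↥(skewSub 4 n N) in 𝓝 0,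
      minAct 4 (sfClass 4 L N ε) L N (j + 1) (chart (ContinuousLinearMap.id ℝ (Matrix n n ℂ)) N V₀ (y : TDir 4 n N)) = w * g (y, zs y) :=
    hkey.mono fun y hy => by rw [hy.minAct_eq, hlev]
  have hgzs : ContDiffAt ℝ 1 (fun y : ↥(skewSub 4 n N) => w * g (y, zs y)) 0 := by
    have h1 : ContDiffAt ℝ 1 (fun y : ↥(skewSub 4 n N) => ((y, zs y) : ↥(skewSub 4 n N) × ↥KT)) 0 := contDiffAt_id.prodMk hzsc
    have h2 : ContDiffAt ℝ 1 g ((fun y : ↥(skewSub 4 n N) => ((y, zs y) : ↥(skewSub 4 n N) × ↥KT)) 0) := by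
      simp only [hzs0, Prod.mk_zero_zero]; exact hgc.of_le (by norm_num)
    have h3 : ContDiffAt ℝ 1 (fun y : ↥(skewSub 4 n N) => g (y, zs y)) 0 :=
      ContDiffAt.comp (g := g) (f := fun y : ↥(skewSub 4 n N) => ((y, zs y) : ↥(skewSub 4 n N) × ↥KT)) 0 h2 h1
    exact contDiffAt_const.mul h3
  refine ⟨Ψ, hΨc, hΨ0, hkeyΨ, ?_⟩
  exact hgzs.congr_of_eventuallyEq hminAct

end

end Summit.QuantumFields.BalabanUV.T4Continuum.NE7MinimiserC1Lift
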